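import Summits.BirchSwinnertonDyer.BirchSwinnertonDyer.Theses.FrozenTwin
import Literature.NumberTheory.EllipticCurves.CongruentNumberCurveAdditiveReduction
import Literature.NumberTheory.EllipticCurves.BSDAnalyticRankTunnellCMProofs
import Literature.NumberTheory.EllipticCurves.BSDWave0TunnellProofs
import Literature.NumberTheory.EllipticCurves.ComplexMultiplicationHasCMProofs
import Literature.NumberTheory.EllipticCurves.ComplexMultiplicationRationalJIntegralProofs
import Literature.NumberTheory.EllipticCurves.PAdicHeightsProofs
import Literature.NumberTheory.EllipticCurves.LFunctionPrimeCoeff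
import Literature.NumberTheory.EllipticCurves.SingularCubicPointCountProofs

/-!
# `SelmerRankCM` (crux stmt-BirchSwinnertonDyer-18086; byte-identical in routes FrozenTwin /
# TangentCone / SelmerRank / ShadowIsolation / ToricShedding): the hypothesis
# `W.HasGoodReductionAtPrime p` is NOT redundant — `5 ≤ p ∧ ¬ p ∣ a_p ∧ W.HasCM` does not imply good
# reduction, because the tree's `frobeniusTrace` is `1` at every prime of ADDITIVE reduction
# (negative-side support, refuter crux-disprover seat cdisprove-18086, cycle 1; load-bearing
# analysis of one hypothesis, NOT a refutation of the crux)

The crux quantifies over `(W, p)` with `5 ≤ p`, `W.HasGoodReductionAtPrime p`,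
`¬ (p : ℤ) ∣ W.frobeniusTrace p`, `W.HasCM`. The informal gloss "good ordinary = the primes split
in the CM field, so `p ∤ a_p` already says everything" suggests dropping the good-reduction
hypothesis. As TYPED that is a strict enlargement of the statement:

* `frobeniusTrace_eq_one_of_hasAdditiveReductionAt` — for a globally minimal elliptic `W/ℚ` and a
  finite place `v` of additive reduction, `W.frobeniusTrace p = 1` (`p` the prime under `v`).
  Reason: `frobeniusTrace W p = p + 1 − reductionPointCount W p` and `reductionPointCount` is
  `Nat.card` of Mathlib's point type of the reduced (singular) cubic, i.e. `#Ẽ_ns(𝔽_p)` WITH the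
  point at infinity and WITHOUT the cusp (`natCard_point_of_Δ_eq_zero`: a cuspidal cubic over `𝔽_q`
  has exactly `q` such points). So at bad primes the tree's `frobeniusTrace` is NOT the Dirichlet
  coefficient `a_p` (which is `0` there, `lFunction_apply_eq_zero_of_hasAdditiveReductionAt`): it is
  `1` (cusp), `2` (split node), `0` (non-split node) — cf. the caveat in the docstring of
  `WeierstrassCurve.LFunction_apply_prime_eq_frobeniusTrace`, which is stated at good primes only.
* `not_dvd_frobeniusTrace_of_hasAdditiveReductionAt` — hence `¬ p ∣ W.frobeniusTrace p` holds
  AUTOMATICALLY at every additive prime: the "ordinarity" hypothesis does not exclude them.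
* `hasGoodReductionAtPrime_or_hasAdditiveReduction_of_hasCM` — a CM curve has good or additive
  reduction at every prime, never multiplicative (`‖j‖_p > 1` at a multiplicative prime versus
  `j ∈ ℤ` for CM, both tree theorems); so for CM curves the cells added by dropping
  `HasGoodReductionAtPrime` are EXACTLY the additive primes `p ≥ 5`.
* `selmerRankCM_hypotheses_not_imp_hasGoodReduction` — **the remaining hypotheses of the crux do
  not imply good reduction**: witness `E₅ : y² = x³ − 25x` (`congruentNumberCurve 5`; `j = 1728`, CM
  by `ℤ[i]`; globally minimal; additive at `5`, `frobeniusTrace E₅ 5 = 1`, `¬ 5 ∣ 1`).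

Consequences recorded for planners/provers. (i) Do not restate the crux without
`HasGoodReductionAtPrime`: the dropped-hypothesis form additionally asserts `corank_5 Sel(E₅) =
r_an(E₅)` and, e.g., `corank_p = r_an` for every CM curve at each of its additive primes `p ≥ 5`
(BSD-true, hence not refutable here, but outside Rubin's ordinary theory: `p` is then ramified or
inert in the CM field or divides the conductor of the Grössencharacter). (ii) Inside the crux the
pair (good, `¬ p ∣ frobeniusTrace`) IS the standard "good ordinary", because at good primes
`frobeniusTrace = a_p` (`LFunction_apply_prime_eq_frobeniusTrace`). (iii) No `_false_without_good`
theorem is claimed: the enlarged statement is implied by BSD ∧ `Ш[p^∞]`-finiteness exactly like the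
crux (`Cruxes/SelmerRankCM/Disproof.lean`, `selmerRankCMWithoutHypotheses_of_bsd_of_shaPFinite`).
-/

noncomputable section

-- D-0017: single-problem summit, so `Summit.BirchSwinnertonDyer.BirchSwinnertonDyer.…` repeats a
-- namespace BY DESIGN.
set_option linter.dupNamespace false

namespace Summit.BirchSwinnertonDyer.BirchSwinnertonDyer.Theorems.SelmerRankCM.Negative

open Literature.NumberTheory.EllipticCurves WeierstrassCurve IsDedekindDomain NumberField
  Rat.HeightOneSpectrum IsLocalRing

/-! ## 1. Additive reduction: the reduced cubic is a cusp, so the tree's `frobeniusTrace` is `1` -/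

section Additive

variable {R : Type*} [CommRing R] [IsDomain R] [IsDiscreteValuationRing R] {K : Type*} [Field K]
  [Algebra R K] [IsFractionRing R K]

/-- At additive reduction the reduction of the (minimal) equation has `Δ = 0` and `c₄ = 0`
(Silverman, *AEC* VII.5 Prop. 5.1(c): `v(Δ) > 0`, `v(c₄) > 0`). [cite: SilvermanAEC2009, Prop. VII.5.1(c)] -/
theorem reduction_Δ_eq_zero_and_c₄_eq_zero_of_hasAdditiveReduction (M : WeierstrassCurve K)
    [IsMinimal R M] (h : M.HasAdditiveReduction R) :
    (M.reduction R).Δ = 0 ∧ (M.reduction R).c₄ = 0 := by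
  have hΔ := h.badReduction
  have hc := h.additiveReduction
  rw [← integralModel_Δ_eq R M] at hΔ
  rw [← integralModel_c₄_eq R M] at hc
  simp only [reduction, map_Δ, map_c₄, residue_eq_zero_iff]
  exact ⟨(HeightOneSpectrum.valuation_lt_one_iff_mem _ _).mp hΔ,
    (HeightOneSpectrum.valuation_lt_one_iff_mem _ _).mp hc⟩

/-- At additive reduction the reduced cubic is cuspidal, so it has exactly `#k` points in
Mathlib's sense (`O` and the nonsingular affine points; `natCard_point_of_Δ_eq_zero`).
[cite: SilvermanAEC2009, Prop. III.2.5 and Exercise 3.5] -/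
theorem natCard_point_reduction_of_hasAdditiveReduction (M : WeierstrassCurve K) [IsMinimal R M]
    [Finite (ResidueField R)] (h : M.HasAdditiveReduction R) :
    Nat.card (M.reduction R).toAffine.Point = Nat.card (ResidueField R) := by
  classical
  obtain ⟨hΔ, hc⟩ := reduction_Δ_eq_zero_and_c₄_eq_zero_of_hasAdditiveReduction M h
  exact (natCard_point_of_Δ_eq_zero _ hΔ).2.2 hc

end Additive

/-- **At a prime of additive reduction the tree's `frobeniusTrace` equals `1`** (globally minimal
elliptic `W/ℚ`, `v` the place over `p`): `reductionPointCount W p = #Ẽ_ns(𝔽_p) = p` for a cusp.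
[cite: SilvermanAEC2009, Prop. VII.5.1(c) and Exercise 3.5] -/
theorem frobeniusTrace_eq_one_of_hasAdditiveReductionAt (W : WeierstrassCurve ℚ) [W.IsElliptic]
    [W.IsGloballyMinimal] (v : HeightOneSpectrum (𝓞 ℚ)) (h : W.HasAdditiveReductionAt v) :
    W.frobeniusTrace (primesEquiv v) = 1 := by
  haveI : Finite (ResidueField (v.adicCompletionIntegers ℚ)) :=
    Nat.finite_of_card_ne_zero (by
      rw [natCard_residueField_adicCompletionIntegers]; exact (primesEquiv v).2.ne_zero)
  have hcount := natCard_point_reduction_minimal_baseChange v W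
  have hcusp := natCard_point_reduction_of_hasAdditiveReduction
    (R := v.adicCompletionIntegers ℚ)
    ((W.baseChange (v.adicCompletion ℚ)).minimal (v.adicCompletionIntegers ℚ)) h
  rw [natCard_residueField_adicCompletionIntegers, hcount] at hcusp
  unfold WeierstrassCurve.frobeniusTrace
  rw [hcusp]
  ring

/-- Hence **`¬ p ∣ W.frobeniusTrace p` holds automatically at every additive prime**: the crux's
ordinarity hypothesis does not exclude additive primes. [folklore] -/
theorem not_dvd_frobeniusTrace_of_hasAdditiveReductionAt (W : WeierstrassCurve ℚ) [W.IsElliptic]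
    [W.IsGloballyMinimal] (v : HeightOneSpectrum (𝓞 ℚ)) (h : W.HasAdditiveReductionAt v) :
    ¬ ((primesEquiv v : ℕ) : ℤ) ∣ W.frobeniusTrace (primesEquiv v) := by
  rw [frobeniusTrace_eq_one_of_hasAdditiveReductionAt W v h]
  intro hd
  have h1 : ((primesEquiv v : ℕ) : ℤ) ≤ 1 := Int.le_of_dvd one_pos hd
  have h2 := (primesEquiv v).2.one_lt
  omega

/-! ## 2. CM curves: good or additive, never multiplicative -/

/-- **A CM curve has good or additive reduction at every prime** (`ℤ_p`-minimal model): a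
multiplicative prime gives `‖j(W)‖_p > 1` (`one_lt_norm_j_of_hasMultiplicativeReductionAtPrime`),
while `j(W) ∈ ℤ` for CM curves (`not_hasCM_of_one_lt_norm_j`, Silverman *Advanced Topics*
II.6.1) — both tree theorems. [cite: SilvermanAEC2009, Prop. VII.5.5] -/
theorem hasGoodReductionAtPrime_or_hasAdditiveReduction_of_hasCM (W : WeierstrassCurve ℚ)
    [W.IsElliptic] (hCM : W.HasCM) (p : ℕ) [Fact p.Prime] :
    W.HasGoodReductionAtPrime p ∨
      ((W.baseChange ℚ_[p]).minimal ℤ_[p]).HasAdditiveReduction ℤ_[p] := by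
  rcases hasGoodReduction_or_hasMultiplicativeReduction_or_hasAdditiveReduction ℤ_[p]
      (W := (W.baseChange ℚ_[p]).minimal ℤ_[p]) with h | h | h
  · exact Or.inl h
  · exact absurd hCM
      (W.not_hasCM_of_one_lt_norm_j (one_lt_norm_j_of_hasMultiplicativeReductionAtPrime h))
  · exact Or.inr h

/-- So for a CM curve, **dropping `HasGoodReductionAtPrime p` from the crux lets in exactly the
additive primes**: `¬ good ↔ additive` (`ℤ_p`-minimal model). [folklore] -/
theorem not_hasGoodReductionAtPrime_iff_hasAdditiveReduction_of_hasCM (W : WeierstrassCurve ℚ)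
    [W.IsElliptic] (hCM : W.HasCM) (p : ℕ) [Fact p.Prime] :
    ¬ W.HasGoodReductionAtPrime p ↔
      ((W.baseChange ℚ_[p]).minimal ℤ_[p]).HasAdditiveReduction ℤ_[p] := by
  constructor
  · intro hng
    exact (hasGoodReductionAtPrime_or_hasAdditiveReduction_of_hasCM W hCM p).resolve_left hng
  · intro hadd hgood
    exact absurd hgood (hadd.not_hasGoodReduction (R := ℤ_[p]))

/-! ## 3. The witness `E₅ : y² = x³ − 25x` at `p = 5` -/

/-- `E₅` is elliptic (`Δ = 64·5⁶ ≠ 0`). [folklore] -/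
theorem isElliptic_E₅ : (congruentNumberCurve 5).IsElliptic :=
  isElliptic_congruentNumberCurve (by norm_num)

/-- `y² = x³ − 25x` is a global minimal model (`5` squarefree). [folklore] -/
theorem isGloballyMinimal_E₅ : (congruentNumberCurve 5).IsGloballyMinimal :=
  isGloballyMinimal_congruentNumberCurve Nat.prime_five.prime.squarefree

-- The two class-valued THEOREMS above are used via `haveI` (no `instance` is added to the tree).

/-- `E₅` has complex multiplication (`j = 1728`, by `ℤ[i]`). [folklore] -/
theorem hasCM_E₅ : (congruentNumberCurve 5).HasCM := by
  haveI := isElliptic_E₅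
  exact hasCM_of_j_eq_1728 _ (congruentNumberCurve_j 5)

/-- The place of `ℚ` over `5`. [folklore] -/
theorem exists_place_five : ∃ v : HeightOneSpectrum (𝓞 ℚ), (primesEquiv v : ℕ) = 5 :=
  ⟨primesEquiv.symm ⟨5, Nat.prime_five⟩, by rw [Equiv.apply_symm_apply]⟩

/-- `E₅` has ADDITIVE reduction at `5` (`ord₅ Δ = 6`, `ord₅ c₄ = 2`; tree theorem
`hasAdditiveReductionAt_congruentNumberCurve_of_dvd`). [cite: SilvermanAEC2009, Prop. VII.5.1(c)] -/
theorem hasAdditiveReductionAt_E₅ (v : HeightOneSpectrum (𝓞 ℚ)) (hv : (primesEquiv v : ℕ) = 5) :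
    (congruentNumberCurve 5).HasAdditiveReductionAt v := by
  have hgen : natGenerator v = 5 := hv
  exact hasAdditiveReductionAt_congruentNumberCurve_of_dvd v Nat.prime_five.prime.squarefree
    (hgen ▸ by norm_num) (hgen ▸ dvd_rfl)

/-- Hence `E₅` does NOT have good reduction at `5`. [folklore] -/
theorem not_hasGoodReductionAtPrime_E₅ [Fact (Nat.Prime 5)] :
    ¬ (congruentNumberCurve 5).HasGoodReductionAtPrime 5 := by
  obtain ⟨v, hv⟩ := exists_place_five
  intro hgood
  have hgood' : (congruentNumberCurve 5).HasGoodReductionAt v :=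
    (hasGoodReductionAtPrime_primesEquiv_iff_holds _ v 5 hv).1 hgood
  exact (hasAdditiveReductionAt_E₅ v hv).not_hasGoodReductionAt hgood'

/-- **`frobeniusTrace E₅ 5 = 1`** (cuspidal reduction `y² = x³` over `𝔽₅`: five points `O`,
`(t², t³)` for `t ∈ 𝔽₅ˣ`). [folklore] -/
theorem frobeniusTrace_E₅_five :
    (haveI := isGloballyMinimal_E₅; (congruentNumberCurve 5).frobeniusTrace 5) = 1 := by
  haveI := isElliptic_E₅
  haveI := isGloballyMinimal_E₅
  obtain ⟨v, hv⟩ := exists_place_five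
  have h := frobeniusTrace_eq_one_of_hasAdditiveReductionAt (congruentNumberCurve 5) v
    (hasAdditiveReductionAt_E₅ v hv)
  rwa [hv] at h

/-- So the crux's ordinarity hypothesis HOLDS at the bad prime `5` of `E₅`. [folklore] -/
theorem not_five_dvd_frobeniusTrace_E₅ :
    ¬ ((5 : ℕ) : ℤ) ∣ (haveI := isGloballyMinimal_E₅; (congruentNumberCurve 5).frobeniusTrace 5) := by
  haveI := isGloballyMinimal_E₅
  rw [show (congruentNumberCurve 5).frobeniusTrace 5 = 1 from frobeniusTrace_E₅_five]
  decide

/-! ## 4. The load-bearing statement -/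

/-- **`HasGoodReductionAtPrime` is not implied by the other hypotheses of `SelmerRankCM`.** The
remaining hypotheses `5 ≤ p`, `¬ p ∣ W.frobeniusTrace p`, `W.HasCM` (with `W` elliptic and globally
minimal) hold at `(E₅, 5)` where the reduction is additive. Consequently the crux with that
hypothesis dropped is a strictly larger statement (it also quantifies over every CM curve at each
of its additive primes `p ≥ 5`), and any proof of the crux may — and Rubin's ordinary theory must —
use good reduction. [folklore] -/
theorem selmerRankCM_hypotheses_not_imp_hasGoodReduction :
    ¬ ∀ (W : WeierstrassCurve ℚ) [W.IsElliptic] [W.IsGloballyMinimal] (p : ℕ) [Fact p.Prime],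
        5 ≤ p → ¬ (p : ℤ) ∣ W.frobeniusTrace p → W.HasCM → W.HasGoodReductionAtPrime p := by
  intro h
  haveI : Fact (Nat.Prime 5) := ⟨Nat.prime_five⟩
  haveI := isElliptic_E₅
  haveI := isGloballyMinimal_E₅
  exact not_hasGoodReductionAtPrime_E₅
    (h (congruentNumberCurve 5) 5 le_rfl not_five_dvd_frobeniusTrace_E₅ hasCM_E₅)

/-- The same witness in `∃`-form: a cell satisfying every hypothesis of the crux except good
reduction, at which the reduction is additive and the tree's `frobeniusTrace` is `1`. [folklore] -/
theorem exists_additive_cell_of_selmerRankCM_hypotheses :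
    ∃ (W : WeierstrassCurve ℚ) (_ : W.IsElliptic) (_ : W.IsGloballyMinimal) (p : ℕ) (_ : Fact p.Prime),
      5 ≤ p ∧ ¬ (p : ℤ) ∣ W.frobeniusTrace p ∧ W.HasCM ∧ ¬ W.HasGoodReductionAtPrime p ∧
        W.frobeniusTrace p = 1 :=
  ⟨congruentNumberCurve 5, isElliptic_E₅, isGloballyMinimal_E₅, 5, ⟨Nat.prime_five⟩, le_rfl,
    not_five_dvd_frobeniusTrace_E₅, hasCM_E₅, not_hasGoodReductionAtPrime_E₅, frobeniusTrace_E₅_five⟩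

end Summit.BirchSwinnertonDyer.BirchSwinnertonDyer.Theorems.SelmerRankCM.Negative

end
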